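import Summits.RiemannHypothesis.RiemannHypothesis.Theorems.SemilocalSoninIneqOn
import HarnessLib

/-!
# The semilocal Sonin inequality below CC's window is purely archimedean — typing lemmas

Cell `rh-explicit`, seat cc-s2-1 (gen 6; lead ruling R8-22 (B): the two-sided picture of the Sonin
threshold `a*_Son({2}) := sup {a | SemilocalSoninIneqOn 2 a}`).  Three elementary facts, PROVED, no
named fact introduced, no RH claim:

* `weilSemilocalPrimeTerm_eq_zero_of_tsupport_subset` — for EVERY finite set of primes `S`, a
  continuous `k` with `tsupport k ⊆ [−log 2, log 2]` has `W_S-prime(k) = Σ_{n : pf(n) ⊆ S} Λ(n)n^{-1/2}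
  (k(log n) + k(−log n)) = 0`: the support of a continuous function is open, so `k(±log n) = 0` for
  every `n ≥ 2` (the boundary points `±log 2` included), and `Λ(0) = Λ(1) = 0`.  Same argument as the
  tree's `weilPrimeTerm_eq_zero_of_tsupport_subset` (Yoshida §0), now for the semilocal coefficient.
* `semilocalSoninIneqOn_iff_arch_of_le` — for `a ≤ (log 2)/2` and any prime `p` the statement
  `SemilocalSoninIneqOn p a` is LITERALLY its `W_p`-free form: `Σ_i Re⟨ξ_i|ϑ(g⋆g̃)ξ_i⟩ ≤ Re W_∞(g⋆g̃)`
  for orthonormal families in the twisted Sonin space `θ_p S(1,1)`.  So on the whole candidate range of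
  the positive side the prime is invisible on the Weil side and enters ONLY through the twist `θ_p`
  of Sonin's space: the statement is Connes–Consani 2021 Theorem 1 with `S(1,1)` replaced by
  `θ_p S(1,1)` (cf. `Literature…WeilArchPositivity_soninTrace`, the `S = {∞}` named fact).
* `semilocalSoninIneqOn_of_nonpos` — the trivial end of the bracket: for `a ≤ 0` the class is `{0}`
  and the statement holds.  With `SoninPoly.Frame050.not_semilocalSoninIneqOn_two_of_gt_half`
  (`¬` for every `a > 1/2`) the THEOREM bracket of record is `a*_Son({2}) ∈ [0, 1/2]`; every positive
  lower bound is an analytic statement (a semilocal Connes–Consani trace formula, not in print —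
  `HOME/cc-s2-3/OPA-SCOPING.md`, seat STATUS 2026-08-22T17:44Z), not a finite certificate.
-/

set_option linter.dupNamespace false  -- the mandated namespace repeats `RiemannHypothesis`

noncomputable section

open MeasureTheory Complex Set
open scoped Real

namespace Summit.RiemannHypothesis.RiemannHypothesis

open Literature.NumberTheory.LFunctions Literature.NumberTheory.ConnesConsani2021

/-- **No prime of any `S` enters below `log 2`.**  If `k` is continuous with
`tsupport k ⊆ [−log 2, log 2]` then the semilocal prime term
`Σ_{n : primeFactors n ⊆ S} Λ(n) n^{-1/2} (k(log n) + k(−log n))` vanishes: `Λ(0) = Λ(1) = 0`, and for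
`n ≥ 2` the points `± log n` lie outside the OPEN set `supp k ⊆ (−log 2, log 2)`.
Semilocal twin of `weilPrimeTerm_eq_zero_of_tsupport_subset`. [cite: Yoshida1992, §0 and §2 eq. (2.1)] -/
theorem weilSemilocalPrimeTerm_eq_zero_of_tsupport_subset (S : Finset ℕ) {k : ℝ → ℂ}
    (hk : Continuous k) (h : tsupport k ⊆ Icc (-Real.log 2) (Real.log 2)) :
    weilSemilocalPrimeTerm S k = 0 := by
  unfold weilSemilocalPrimeTerm
  refine (tsum_congr fun n ↦ ?_).trans tsum_zero
  have hsupp := support_subset_Ioo_of_tsupport_subset_Icc hk h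
  rcases Nat.lt_or_ge n 2 with hn | hn
  · interval_cases n <;> simp [weilSemilocalCoeff]
  · have hlog : Real.log 2 ≤ Real.log n :=
      Real.log_le_log two_pos (by exact_mod_cast hn)
    have h1 : k (Real.log n) = 0 := by
      by_contra hne
      have := (hsupp hne).2
      linarith
    have h2 : k (-Real.log n) = 0 := by
      by_contra hne
      have := (hsupp hne).1
      linarith
    simp [h1, h2]

/-- On a window `supp g ⊆ [−a, a]` with `a ≤ (log 2)/2` the semilocal prime term of `g ⋆ g̃`
vanishes for every `S` (`supp (g ⋆ g̃) ⊆ [−2a, 2a] ⊆ [−log 2, log 2]`). [cite: Yoshida1992, §2 (supp F ⊆ [−2a, 2a])] -/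
theorem weilSemilocalPrimeTerm_weilConv_eq_zero_of_le (S : Finset ℕ) {a : ℝ}
    (ha : a ≤ Real.log 2 / 2) {g : ℝ → ℂ} (hg : IsWeilTest g) (hsupp : tsupport g ⊆ Icc (-a) a) :
    weilSemilocalPrimeTerm S (weilConv g (weilReflect g)) = 0 :=
  weilSemilocalPrimeTerm_eq_zero_of_tsupport_subset S (hg.weilConv hg.weilReflect).1.continuous
    ((tsupport_weilConv_weilReflect_subset hg.2 hsupp).trans
      (Icc_subset_Icc (by linarith) (by linarith)))

/-- **Below CC's window the semilocal Sonin inequality is purely archimedean.**  For `a ≤ (log 2)/2`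
and any prime `p`, `SemilocalSoninIneqOn p a` is equivalent to its `W_p`-free form
`Σ_i Re⟨ξ_i|ϑ(g⋆g̃)ξ_i⟩ ≤ Re W_∞(g⋆g̃)` over orthonormal families of the twisted Sonin space
`θ_p S(1,1)` — i.e. to Connes–Consani 2021 Theorem 1 with Sonin's space replaced by its `θ_p`-image;
the prime acts only through the twist. [cite: ConnesConsani2021, Thm. 1 (Intro p. 4) — the archimedean shape being compared] -/
theorem semilocalSoninIneqOn_iff_arch_of_le {p : ℕ} [Fact p.Prime] {a : ℝ}
    (ha : a ≤ Real.log 2 / 2) :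
    SemilocalSoninIneqOn p a ↔
      ∀ g : ℝ → ℂ, IsWeilTest g → tsupport g ⊆ Icc (-a) a →
        mulFourier g (I / 2) = 0 → mulFourier g 0 = 0 →
        ∀ (n : ℕ) (ξ : Fin n → Lp ℂ 2 (volume : Measure ℝ)),
          Orthonormal ℂ ξ → (∀ i, ξ i ∈ semilocalSoninSpace p 1 1) →
            ∑ i, (soninTraceForm (weilConv g (weilReflect g)) (ξ i : ℝ → ℂ)).re
              ≤ (archW (weilConv g (weilReflect g))).re := by
  constructor
  · intro h g hg hsupp h1 h0 n ξ hξ hS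
    have key := h g hg hsupp h1 h0 n ξ hξ hS
    rwa [weilSemilocalPrimeTerm_weilConv_eq_zero_of_le {p} ha hg hsupp, sub_zero] at key
  · intro h g hg hsupp h1 h0 n ξ hξ hS
    rw [weilSemilocalPrimeTerm_weilConv_eq_zero_of_le {p} ha hg hsupp, sub_zero]
    exact h g hg hsupp h1 h0 n ξ hξ hS

/-- **The trivial end of the bracket**: for `a ≤ 0` the admissible class is `{0}`, `g ⋆ g̃ = 0`, every
Sonin matrix coefficient and both Weil terms vanish, and `SemilocalSoninIneqOn p a` holds.  Together
with `SoninPoly.Frame050.not_semilocalSoninIneqOn_two_of_gt_half` the theorem bracket for the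
threshold is `[0, 1/2]`. [folklore] -/
theorem semilocalSoninIneqOn_of_nonpos (p : ℕ) [Fact p.Prime] {a : ℝ} (ha : a ≤ 0) :
    SemilocalSoninIneqOn p a := by
  intro g hg hsupp h1 h0 n ξ hξ hS
  -- the support of `g` is open and sits inside `(−a, a) = ∅`, so `g = 0`
  -- (cf. `WindowStep.Negative.eq_zero_of_tsupport_subset_Icc_nonpos`, not imported to keep this file light)
  have hg0 : g = 0 := by
    have hsub := support_subset_Ioo_of_tsupport_subset_Icc hg.1.continuous hsupp
    rwa [Ioo_eq_empty (by intro h; linarith), subset_empty_iff, Function.support_eq_empty_iff] at hsub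
  have hrefl : weilReflect (0 : ℝ → ℂ) = 0 := by
    funext t; simp [weilReflect]
  have hk : weilConv g (weilReflect g) = 0 := by
    rw [hg0, hrefl, weilConv, zero_convolution]
  rw [hk]
  simp [soninTraceForm, archW, weilArchTermBombieri, weilSemilocalPrimeTerm]

end Summit.RiemannHypothesis.RiemannHypothesis
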